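import Summits.HodgeConjecture.HodgeConjecture.Theorems.R90S9SignedClauseCongrTransport     -- ★ p861743 (this seat): `cmNonsplitClause_transport_formCongr` (+ ★ p861691 engine)
import Summits.HodgeConjecture.HodgeConjecture.Theorems.R90S9SplitLetterCongrTransport       -- ★ p861795 (this seat): `cmSplitCharIdentityAtTest_transport_formCongr`
import Literature.NumberTheory.Automorphic.AdelicCongruenceLocalCompat                          -- ★ `formCongr_toLocalGL_one_smul` (the rational congruence read over `L ⊗ L⁺_v`), `toLocalGL`
import Literature.NumberTheory.Automorphic.UnitaryGroupFormTransport                            -- ★ `formCongr_inv_formCongr`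
import HarnessLib

/-!
# R90-TF · S9 «InnerForm-13.3.6 (c)» — (B3d, d3-pkg) THE SIGNED Q-PACKAGE OF RECORD RIDES THE SIMILITUDE `ᵗB̄ (a • Φ₃) B = H` TO THE QUASI-SPLIT MODEL

Cell `hodgecm-mathlib`, crux H413 (`stmt-HodgeConjecture-24833`, lane `--supports`), route of record `HCCMUnconditional` (no route verbs; count-neutral).  Programme
R90-TF (brief `director/R90-BRIEF.v2.md` 1f40d54518340a35), section S9 (base `R90-IF`); seat R90-IF-p03 (g0), RE-DEAL «p03 → B3d (S-G) DATA + PACKAGE TRANSPORT ALONG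
THE LOCAL CONGRUENCE» (R90-IF-plan (g0), `R90/STATUS.md` 2026-09-04T15:43:02Z; the dealt file name), census `R90/R90-IF-p03/g0/CENSUS-B3d.md` item (d3-pkg).  THEOREMS
ONLY, sorry-free, over ★ currency.  HONEST LABEL: HC_CM is proved only modulo the 7 printed citations (2 remaining named inputs: hLiu418 = stmt-HodgeConjecture-24832,
h413 = stmt-HodgeConjecture-24833) until rung 0 closes; this file proves no printed statement — it assembles the per-place transports (★ p861691, p861743, p861795) into
the transport of the `hQS` binder of (B0) `R90.S9.XiMembershipAt` from `U(H)` to `U(Φ₃)` along a rational similitude, for FILE B's socket `sock_S9_similitudeTransport` (B3).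

THE MATHEMATICS.  (d0) A rational similitude `ᵗB̄ · (a • Φ₃) · B = H` (`B ∈ GL₃(L)`, `a ∈ L⁺`, `a ≠ 0`; the B3 binders) gives at EVERY finite `v` the H-frame
`ᵗ(σT_v)·H_v·T_v = a_v·Φ₃` with `T_v := (B ⊗ 1)_v⁻¹`, `a_v := a ⊗ 1` a `σ`-fixed unit (★ `formCongr_toLocalGL_one_smul`, ★ `formCongr_inv_formCongr`), hence the local
congruences `e_v := cmDatumLocalCongr L v T_v _ _ : U(Φ₃)_v ≃ₜ* U(H)_v` (`e_v⁻¹ x = B_v x B_v⁻¹`, p01's `Φ` read at `v`).  (d3-pkg) For ANY such family of H-frames, the SIGNED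
Q-package of record ★ `CMCharIdentityPackageTestSigned L H hH hHd νH νG μω hμu Δ‴_H mH mG` — for every global character `ξ`: the signed non-split letters at every H-frame and
the split letters — implies the signed Q-package for `Φ₃` at the TRANSPORTED data `(νH, e⁻¹_* νG, Δ‴_{Φ₃}, mH, e⁻¹_* mG)` with the hermitian witnesses
`antidiagOne_isHermitian L 3`, `isUnit_antidiagOne_det L 3` of FILE B's `SocketQsXiMembership`: non-split conjunct by ★ p861743 `cmNonsplitClause_transport_formCongr`
(product frames + the engine ★ p861691 + sign constancy), split conjunct by ★ p861795 `cmSplitCharIdentityAtTest_transport_formCongr` (κ = 1 at split places).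
[Rogawski1990 §13.1 Prop. 13.1.4 p. 199; §14.2 pp. 232–234 «we fix an isomorphism `ψ : G′ → G` …»; §14.6 p. 242; LanglandsShelstad1987 §1, §4.2.]

* §1 `formCongr_toLocalGL_inv_of_simil`, `isUnit_algebraMap_localRing_of_ne_zero`, `conjLocal_algebraMap_of_cmConj_eq` — (d0) the local H-frames of the similitude.
* §2 **`cmCharIdentityPackageTestSigned_transport_formCongr`** — (d3-pkg) over any family of H-frames `(T_v, a_v)`.
* §3 **`cmCharIdentityPackageTestSigned_transport_of_simil`** — (d3-pkg) over the B3 binders `(B, a)`, the form the glue of `sock_S9_similitudeTransport` consumes BY NAME.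

## References
* [Rogawski1990] J. D. Rogawski, *Automorphic Representations of Unitary Groups in Three Variables*, Ann. of Math. Stud. 123 (1990): §13.1 Prop. 13.1.4 p. 199; §4.9 p. 55;
  §14.2 pp. 232–234; §14.6 p. 242; §1.9 p. 8.
* [LanglandsShelstad1987] R. P. Langlands, D. Shelstad, *On the definition of transfer factors*, Math. Ann. 278 (1987): §1, §4.2.
* [PlatonovRapinchuk1994] V. Platonov, A. Rapinchuk, *Algebraic Groups and Number Theory* (1994), §2.3.
-/

set_option autoImplicit false
-- the mandated namespace repeats `HodgeConjecture.HodgeConjecture`, as in every `Theorems/*.lean` of this sub-problem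
set_option linter.dupNamespace false

noncomputable section

open NumberField IsDedekindDomain MeasureTheory MeasureTheory.Measure
open scoped Matrix MatrixGroups
open Literature.NumberTheory.Rogawski1990 Literature.NumberTheory.Automorphic Literature.NumberTheory.Automorphic.UnitaryGroup
open Literature.NumberTheory.GaloisRepresentations
open Summit.HodgeConjecture.HodgeConjecture.Cruxes.H413

namespace Summit.HodgeConjecture.HodgeConjecture.R90.S9

/-! ## §1 (d0) The local H-frames of a rational similitude -/

section Frames

variable (L : Type) [Field L] [NumberField L] [IsCMField L] (H : Matrix (Fin 3) (Fin 3) L)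

/-- **The local H-frame of a rational similitude**: from `ᵗB̄ · (a • Φ₃) · B = H` over `L`, at every finite `v`:
`ᵗ(σ(B_v⁻¹)) · H_v · B_v⁻¹ = (a ⊗ 1) • Φ₃` (★ `formCongr_toLocalGL_one_smul` read backwards through ★ `formCongr_inv_formCongr`; `(a • Φ₃) ⊗ 1 = (a ⊗ 1) • (Φ₃ ⊗ 1)`).
[cite: PlatonovRapinchuk1994, §2.3] [cite: Rogawski1990, §14.2 p. 232] -/
theorem formCongr_toLocalGL_inv_of_simil (B : GL (Fin 3) L) (a : L) (hB : formCongr (cmConjRingHom L) B (a • qsForm L) = H)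
    (v : HeightOneSpectrum (𝓞 ↥(maximalRealSubfield L))) :
    formCongr (conjLocal L (IsCMField.complexConj L) v) (toLocalGL L v B)⁻¹ (H.map (algebraMap L (UnitaryGroup.LocalRing L v))) =
      algebraMap L (UnitaryGroup.LocalRing L v) a •
        (Matrix.of fun i j : Fin 3 => if i.val + j.val + 1 = 3 then (1 : L) else 0).map (algebraMap L (UnitaryGroup.LocalRing L v)) := by
  have h1 := formCongr_toLocalGL_one_smul L (H₀ := a • qsForm L) (H' := H) B hB v
  rw [one_smul] at h1
  rw [← h1, formCongr_inv_formCongr, Matrix.map_smul' _ _ _ (map_mul (algebraMap L (UnitaryGroup.LocalRing L v)))]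

omit [IsCMField L] in
/-- `a ⊗ 1` is a unit of `L ⊗ L⁺_v` for `a ≠ 0`. [cite: PlatonovRapinchuk1994, §2.3] -/
theorem isUnit_algebraMap_localRing_of_ne_zero {a : L} (ha0 : a ≠ 0) (v : HeightOneSpectrum (𝓞 ↥(maximalRealSubfield L))) :
    IsUnit (algebraMap L (UnitaryGroup.LocalRing L v) a) :=
  (IsUnit.mk0 a ha0).map (algebraMap L (UnitaryGroup.LocalRing L v))

/-- `a ⊗ 1` is `σ`-fixed when `ā = a` (★ `algebraMap_localRing_conj`). [cite: PlatonovRapinchuk1994, §2.3] -/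
theorem conjLocal_algebraMap_of_cmConj_eq {a : L} (haσ : cmConjRingHom L a = a) (v : HeightOneSpectrum (𝓞 ↥(maximalRealSubfield L))) :
    conjLocal L (IsCMField.complexConj L) v (algebraMap L (UnitaryGroup.LocalRing L v) a) = algebraMap L (UnitaryGroup.LocalRing L v) a := by
  have h := algebraMap_localRing_conj L (IsCMField.complexConj L) v a
  have hfix : ((IsCMField.complexConj L : L ≃ₐ[↥(maximalRealSubfield L)] L) : L →+* L) a = a := haσ
  rw [hfix] at h
  exact h.symm

end Frames

/-! ## §2 (d3-pkg) The signed Q-package rides a family of H-frames -/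

section Package

variable (L : Type) [Field L] [NumberField L] [IsCMField L] (H : Matrix (Fin 3) (Fin 3) L)
  (hH : (H.map (cmConjRingHom L))ᵀ = H) (hHd : IsUnit H.det)

open scoped Classical in
set_option synthInstance.maxHeartbeats 400000 in
set_option maxHeartbeats 4000000 in
/-- **(B3d, d3-pkg) THE SIGNED Q-PACKAGE OF RECORD RIDES A FAMILY OF H-FRAMES TO THE QUASI-SPLIT MODEL.**  For a hermitian `H` (`det H` a unit), a family of
H-frames `ᵗ(σT_v)·H_v·T_v = a_v·Φ₃` at every finite `v` (`a_v` `σ`-fixed units; `e_v := cmDatumLocalCongr L v (T_v) …`), Haar measures `ν_G v` on `U(H)_v`: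
`CMCharIdentityPackageTestSigned L H hH hHd νH νG μω hμu Δ‴_H mH mG → CMCharIdentityPackageTestSigned L Φ₃ _ _ νH (e⁻¹_* νG) μω hμu Δ‴_{Φ₃} mH (e⁻¹_* mG)`, with FILE B's
witnesses `antidiagOne_isHermitian L 3`, `isUnit_antidiagOne_det L 3` for `Φ₃ = qsForm L`.  Per `ξ`: the non-split conjunct by ★ `cmNonsplitClause_transport_formCongr`, the
split conjunct by ★ `cmSplitCharIdentityAtTest_transport_formCongr`. [cite: Rogawski1990, §13.1 Prop. 13.1.4 p. 199; §14.2 pp. 232–234; §14.6 p. 242] [cite: LanglandsShelstad1987, §1, §4.2] -/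
theorem cmCharIdentityPackageTestSigned_transport_formCongr
    (Tᵥ : ∀ v : HeightOneSpectrum (𝓞 ↥(maximalRealSubfield L)), GL (Fin 3) (UnitaryGroup.LocalRing L v))
    (aᵥ : ∀ v : HeightOneSpectrum (𝓞 ↥(maximalRealSubfield L)), UnitaryGroup.LocalRing L v) (haᵥ : ∀ v, IsUnit (aᵥ v))
    (haσ : ∀ v, conjLocal L (IsCMField.complexConj L) v (aᵥ v) = aᵥ v)
    (hᵥ : ∀ v : HeightOneSpectrum (𝓞 ↥(maximalRealSubfield L)),
      formCongr (conjLocal L (IsCMField.complexConj L) v) (Tᵥ v) (H.map (algebraMap L (UnitaryGroup.LocalRing L v))) =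
        aᵥ v • (Matrix.of fun i j : Fin 3 => if i.val + j.val + 1 = 3 then (1 : L) else 0).map (algebraMap L (UnitaryGroup.LocalRing L v)))
    [∀ v : HeightOneSpectrum (𝓞 ↥(maximalRealSubfield L)), MeasurableSpace ((UnitaryGroup.cmDatum L 3 H).Local v)]
    [∀ v : HeightOneSpectrum (𝓞 ↥(maximalRealSubfield L)), BorelSpace ((UnitaryGroup.cmDatum L 3 H).Local v)]
    [∀ v : HeightOneSpectrum (𝓞 ↥(maximalRealSubfield L)), MeasurableSpace ((UnitaryGroup.cmDatum L 3 (Matrix.of fun i j : Fin 3 => if i.val + j.val + 1 = 3 then (1 : L) else 0)).Local v)]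
    [∀ v : HeightOneSpectrum (𝓞 ↥(maximalRealSubfield L)), BorelSpace ((UnitaryGroup.cmDatum L 3 (Matrix.of fun i j : Fin 3 => if i.val + j.val + 1 = 3 then (1 : L) else 0)).Local v)]
    [∀ (v : HeightOneSpectrum (𝓞 ↥(maximalRealSubfield L))) (γ : (UnitaryGroup.cmDatum L 3 H).Local v),
      MeasurableSpace (((UnitaryGroup.cmDatum L 3 H).Local v) ⧸ Subgroup.centralizer ({γ} : Set ((UnitaryGroup.cmDatum L 3 H).Local v)))]
    [∀ (v : HeightOneSpectrum (𝓞 ↥(maximalRealSubfield L))) (γ : (UnitaryGroup.cmDatum L 3 H).Local v),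
      BorelSpace (((UnitaryGroup.cmDatum L 3 H).Local v) ⧸ Subgroup.centralizer ({γ} : Set ((UnitaryGroup.cmDatum L 3 H).Local v)))]
    [∀ (v : HeightOneSpectrum (𝓞 ↥(maximalRealSubfield L))) (γ : (UnitaryGroup.cmDatum L 3 (Matrix.of fun i j : Fin 3 => if i.val + j.val + 1 = 3 then (1 : L) else 0)).Local v),
      MeasurableSpace (((UnitaryGroup.cmDatum L 3 (Matrix.of fun i j : Fin 3 => if i.val + j.val + 1 = 3 then (1 : L) else 0)).Local v) ⧸
        Subgroup.centralizer ({γ} : Set ((UnitaryGroup.cmDatum L 3 (Matrix.of fun i j : Fin 3 => if i.val + j.val + 1 = 3 then (1 : L) else 0)).Local v)))]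
    [∀ (v : HeightOneSpectrum (𝓞 ↥(maximalRealSubfield L))) (γ : (UnitaryGroup.cmDatum L 3 (Matrix.of fun i j : Fin 3 => if i.val + j.val + 1 = 3 then (1 : L) else 0)).Local v),
      BorelSpace (((UnitaryGroup.cmDatum L 3 (Matrix.of fun i j : Fin 3 => if i.val + j.val + 1 = 3 then (1 : L) else 0)).Local v) ⧸
        Subgroup.centralizer ({γ} : Set ((UnitaryGroup.cmDatum L 3 (Matrix.of fun i j : Fin 3 => if i.val + j.val + 1 = 3 then (1 : L) else 0)).Local v)))]
    [∀ v : HeightOneSpectrum (𝓞 ↥(maximalRealSubfield L)),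
      MeasurableSpace ((UnitaryGroup.cmDatum L 2 (Matrix.of fun i j : Fin 2 => if i.val + j.val + 1 = 2 then (1 : L) else 0)).Local v ×
        (UnitaryGroup.cmDatum L 1 (Matrix.of fun i j : Fin 1 => if i.val + j.val + 1 = 1 then (1 : L) else 0)).Local v)]
    [∀ (v : HeightOneSpectrum (𝓞 ↥(maximalRealSubfield L)))
        (a' : (UnitaryGroup.cmDatum L 2 (Matrix.of fun i j : Fin 2 => if i.val + j.val + 1 = 2 then (1 : L) else 0)).Local v ×
          (UnitaryGroup.cmDatum L 1 (Matrix.of fun i j : Fin 1 => if i.val + j.val + 1 = 1 then (1 : L) else 0)).Local v),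
      MeasurableSpace (((UnitaryGroup.cmDatum L 2 (Matrix.of fun i j : Fin 2 => if i.val + j.val + 1 = 2 then (1 : L) else 0)).Local v ×
          (UnitaryGroup.cmDatum L 1 (Matrix.of fun i j : Fin 1 => if i.val + j.val + 1 = 1 then (1 : L) else 0)).Local v) ⧸
        Subgroup.centralizer ({a'} : Set ((UnitaryGroup.cmDatum L 2 (Matrix.of fun i j : Fin 2 => if i.val + j.val + 1 = 2 then (1 : L) else 0)).Local v ×
          (UnitaryGroup.cmDatum L 1 (Matrix.of fun i j : Fin 1 => if i.val + j.val + 1 = 1 then (1 : L) else 0)).Local v)))]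
    (mH : ∀ v : HeightOneSpectrum (𝓞 ↥(maximalRealSubfield L)),
      OrbitalMeasureFamily ((UnitaryGroup.cmDatum L 2 (Matrix.of fun i j : Fin 2 => if i.val + j.val + 1 = 2 then (1 : L) else 0)).Local v ×
        (UnitaryGroup.cmDatum L 1 (Matrix.of fun i j : Fin 1 => if i.val + j.val + 1 = 1 then (1 : L) else 0)).Local v))
    (mG : ∀ v : HeightOneSpectrum (𝓞 ↥(maximalRealSubfield L)), OrbitalMeasureFamily ((UnitaryGroup.cmDatum L 3 H).Local v))
    (νG : ∀ v : HeightOneSpectrum (𝓞 ↥(maximalRealSubfield L)), Measure ((UnitaryGroup.cmDatum L 3 H).Local v))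
    [∀ v : HeightOneSpectrum (𝓞 ↥(maximalRealSubfield L)), (νG v).IsHaarMeasure]
    (νH : ∀ v : HeightOneSpectrum (𝓞 ↥(maximalRealSubfield L)),
      Measure ((UnitaryGroup.cmDatum L 2 (Matrix.of fun i j : Fin 2 => if i.val + j.val + 1 = 2 then (1 : L) else 0)).Local v ×
        (UnitaryGroup.cmDatum L 1 (Matrix.of fun i j : Fin 1 => if i.val + j.val + 1 = 1 then (1 : L) else 0)).Local v))
    (μω : HeckeCharacter L) (hμu : μω.IsUnitary)
    (hQS : CMCharIdentityPackageTestSigned L H hH hHd νH νG μω hμu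
      (finExplicitCollection L H μω (finExplicitDelta_conj_left_all L H μω) (finExplicitDelta_conj_right_all L H μω)) mH mG) :
    CMCharIdentityPackageTestSigned L (Matrix.of fun i j : Fin 3 => if i.val + j.val + 1 = 3 then (1 : L) else 0) (antidiagOne_isHermitian L 3)
      (isUnit_antidiagOne_det L 3) νH (fun v => (νG v).map (cmDatumLocalCongr L v (Tᵥ v) (haᵥ v) (hᵥ v)).symm) μω hμu
      (finExplicitCollection L (Matrix.of fun i j : Fin 3 => if i.val + j.val + 1 = 3 then (1 : L) else 0) μω
        (finExplicitDelta_conj_left_all L (Matrix.of fun i j : Fin 3 => if i.val + j.val + 1 = 3 then (1 : L) else 0) μω)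
        (finExplicitDelta_conj_right_all L (Matrix.of fun i j : Fin 3 => if i.val + j.val + 1 = 3 then (1 : L) else 0) μω)) mH
      (fun v => (mG v).transport (cmDatumLocalCongr L v (Tᵥ v) (haᵥ v) (hᵥ v)).symm.toMulEquiv
        (cmDatumLocalCongr L v (Tᵥ v) (haᵥ v) (hᵥ v)).symm.continuous (cmDatumLocalCongr L v (Tᵥ v) (haᵥ v) (hᵥ v)).continuous) := by
  intro ξ
  refine ⟨fun v hns T'' a'' ha'' h'' => ?_, fun v hs => ?_⟩
  · obtain ⟨w⟩ := (inferInstance : Nonempty (PlacesOver L v))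
    intro _ _ μZ _ π2 πn hK hn
    exact cmNonsplitClause_transport_formCongr L H v μω w (hns w) hns hH hHd (Tᵥ v) (haᵥ v) (haσ v) (hᵥ v) (mH v) (mG v) (νG v) (νH v) ξ
      (fun T a ha h => (hQS ξ).1 v hns T a ha h) T'' a'' ha'' h'' μZ π2 πn hK hn
  · exact cmSplitCharIdentityAtTest_transport_formCongr L H v (Tᵥ v) (haᵥ v) (hᵥ v) μω hH hHd (splitWitness v hs) (splitWitness_spec v hs) _ _ _ _ _ _
      (mH v) (mG v) (νG v) (νH v) (ξ.xiLocalChar v) ((hQS ξ).2 v hs)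

end Package

/-! ## §3 (d3-pkg) The signed Q-package rides the rational similitude of (B3) -/

section Simil

variable (L : Type) [Field L] [NumberField L] [IsCMField L] (H : Matrix (Fin 3) (Fin 3) L)
  (hH : (H.map (cmConjRingHom L))ᵀ = H) (hHd : IsUnit H.det)

open scoped Classical in
set_option synthInstance.maxHeartbeats 400000 in
set_option maxHeartbeats 4000000 in
/-- **(B3d, d3-pkg — the glue's form) THE SIGNED Q-PACKAGE OF RECORD RIDES THE RATIONAL SIMILITUDE `ᵗB̄ · (a • Φ₃) · B = H`** (the binders of FILE B's
`SocketSimilitudeTransport`: `B : GL₃(L)`, `ā = a ≠ 0`): with the H-frames `T_v := (B ⊗ 1)_v⁻¹`, `a_v := a ⊗ 1` of §1 and `e_v := cmDatumLocalCongr L v T_v _ _`,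
`CMCharIdentityPackageTestSigned L H hH hHd νH νG μω hμu Δ‴_H mH mG → CMCharIdentityPackageTestSigned L (qsForm L) (antidiagOne_isHermitian L 3) (isUnit_antidiagOne_det L 3)
νH (e⁻¹_* νG) μω hμu Δ‴_{Φ₃} mH (e⁻¹_* mG)` — the `hQS` binder of (B0) `XiMembershipAt L (qsForm L) …` from that of `XiMembershipAt L H hH hHd` (§2 at the §1 frames).
[cite: Rogawski1990, §13.1 Prop. 13.1.4 p. 199; §14.2 pp. 232–234; §14.6 p. 242; §1.9 p. 8] [cite: LanglandsShelstad1987, §1, §4.2] [cite: PlatonovRapinchuk1994, §2.3] -/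
theorem cmCharIdentityPackageTestSigned_transport_of_simil (B : GL (Fin 3) L) (a : L) (haσ : cmConjRingHom L a = a) (ha0 : a ≠ 0)
    (hB : formCongr (cmConjRingHom L) B (a • qsForm L) = H)
    [∀ v : HeightOneSpectrum (𝓞 ↥(maximalRealSubfield L)), MeasurableSpace ((UnitaryGroup.cmDatum L 3 H).Local v)]
    [∀ v : HeightOneSpectrum (𝓞 ↥(maximalRealSubfield L)), BorelSpace ((UnitaryGroup.cmDatum L 3 H).Local v)]
    [∀ v : HeightOneSpectrum (𝓞 ↥(maximalRealSubfield L)), MeasurableSpace ((UnitaryGroup.cmDatum L 3 (Matrix.of fun i j : Fin 3 => if i.val + j.val + 1 = 3 then (1 : L) else 0)).Local v)]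
    [∀ v : HeightOneSpectrum (𝓞 ↥(maximalRealSubfield L)), BorelSpace ((UnitaryGroup.cmDatum L 3 (Matrix.of fun i j : Fin 3 => if i.val + j.val + 1 = 3 then (1 : L) else 0)).Local v)]
    [∀ (v : HeightOneSpectrum (𝓞 ↥(maximalRealSubfield L))) (γ : (UnitaryGroup.cmDatum L 3 H).Local v),
      MeasurableSpace (((UnitaryGroup.cmDatum L 3 H).Local v) ⧸ Subgroup.centralizer ({γ} : Set ((UnitaryGroup.cmDatum L 3 H).Local v)))]
    [∀ (v : HeightOneSpectrum (𝓞 ↥(maximalRealSubfield L))) (γ : (UnitaryGroup.cmDatum L 3 H).Local v),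
      BorelSpace (((UnitaryGroup.cmDatum L 3 H).Local v) ⧸ Subgroup.centralizer ({γ} : Set ((UnitaryGroup.cmDatum L 3 H).Local v)))]
    [∀ (v : HeightOneSpectrum (𝓞 ↥(maximalRealSubfield L))) (γ : (UnitaryGroup.cmDatum L 3 (Matrix.of fun i j : Fin 3 => if i.val + j.val + 1 = 3 then (1 : L) else 0)).Local v),
      MeasurableSpace (((UnitaryGroup.cmDatum L 3 (Matrix.of fun i j : Fin 3 => if i.val + j.val + 1 = 3 then (1 : L) else 0)).Local v) ⧸
        Subgroup.centralizer ({γ} : Set ((UnitaryGroup.cmDatum L 3 (Matrix.of fun i j : Fin 3 => if i.val + j.val + 1 = 3 then (1 : L) else 0)).Local v)))]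
    [∀ (v : HeightOneSpectrum (𝓞 ↥(maximalRealSubfield L))) (γ : (UnitaryGroup.cmDatum L 3 (Matrix.of fun i j : Fin 3 => if i.val + j.val + 1 = 3 then (1 : L) else 0)).Local v),
      BorelSpace (((UnitaryGroup.cmDatum L 3 (Matrix.of fun i j : Fin 3 => if i.val + j.val + 1 = 3 then (1 : L) else 0)).Local v) ⧸
        Subgroup.centralizer ({γ} : Set ((UnitaryGroup.cmDatum L 3 (Matrix.of fun i j : Fin 3 => if i.val + j.val + 1 = 3 then (1 : L) else 0)).Local v)))]
    [∀ v : HeightOneSpectrum (𝓞 ↥(maximalRealSubfield L)),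
      MeasurableSpace ((UnitaryGroup.cmDatum L 2 (Matrix.of fun i j : Fin 2 => if i.val + j.val + 1 = 2 then (1 : L) else 0)).Local v ×
        (UnitaryGroup.cmDatum L 1 (Matrix.of fun i j : Fin 1 => if i.val + j.val + 1 = 1 then (1 : L) else 0)).Local v)]
    [∀ (v : HeightOneSpectrum (𝓞 ↥(maximalRealSubfield L)))
        (a' : (UnitaryGroup.cmDatum L 2 (Matrix.of fun i j : Fin 2 => if i.val + j.val + 1 = 2 then (1 : L) else 0)).Local v ×
          (UnitaryGroup.cmDatum L 1 (Matrix.of fun i j : Fin 1 => if i.val + j.val + 1 = 1 then (1 : L) else 0)).Local v),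
      MeasurableSpace (((UnitaryGroup.cmDatum L 2 (Matrix.of fun i j : Fin 2 => if i.val + j.val + 1 = 2 then (1 : L) else 0)).Local v ×
          (UnitaryGroup.cmDatum L 1 (Matrix.of fun i j : Fin 1 => if i.val + j.val + 1 = 1 then (1 : L) else 0)).Local v) ⧸
        Subgroup.centralizer ({a'} : Set ((UnitaryGroup.cmDatum L 2 (Matrix.of fun i j : Fin 2 => if i.val + j.val + 1 = 2 then (1 : L) else 0)).Local v ×
          (UnitaryGroup.cmDatum L 1 (Matrix.of fun i j : Fin 1 => if i.val + j.val + 1 = 1 then (1 : L) else 0)).Local v)))]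
    (mH : ∀ v : HeightOneSpectrum (𝓞 ↥(maximalRealSubfield L)),
      OrbitalMeasureFamily ((UnitaryGroup.cmDatum L 2 (Matrix.of fun i j : Fin 2 => if i.val + j.val + 1 = 2 then (1 : L) else 0)).Local v ×
        (UnitaryGroup.cmDatum L 1 (Matrix.of fun i j : Fin 1 => if i.val + j.val + 1 = 1 then (1 : L) else 0)).Local v))
    (mG : ∀ v : HeightOneSpectrum (𝓞 ↥(maximalRealSubfield L)), OrbitalMeasureFamily ((UnitaryGroup.cmDatum L 3 H).Local v))
    (νG : ∀ v : HeightOneSpectrum (𝓞 ↥(maximalRealSubfield L)), Measure ((UnitaryGroup.cmDatum L 3 H).Local v))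
    [∀ v : HeightOneSpectrum (𝓞 ↥(maximalRealSubfield L)), (νG v).IsHaarMeasure]
    (νH : ∀ v : HeightOneSpectrum (𝓞 ↥(maximalRealSubfield L)),
      Measure ((UnitaryGroup.cmDatum L 2 (Matrix.of fun i j : Fin 2 => if i.val + j.val + 1 = 2 then (1 : L) else 0)).Local v ×
        (UnitaryGroup.cmDatum L 1 (Matrix.of fun i j : Fin 1 => if i.val + j.val + 1 = 1 then (1 : L) else 0)).Local v))
    (μω : HeckeCharacter L) (hμu : μω.IsUnitary)
    (hQS : CMCharIdentityPackageTestSigned L H hH hHd νH νG μω hμu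
      (finExplicitCollection L H μω (finExplicitDelta_conj_left_all L H μω) (finExplicitDelta_conj_right_all L H μω)) mH mG) :
    CMCharIdentityPackageTestSigned L (qsForm L) (antidiagOne_isHermitian L 3) (isUnit_antidiagOne_det L 3) νH
      (fun v => (νG v).map (cmDatumLocalCongr L v (toLocalGL L v B)⁻¹ (isUnit_algebraMap_localRing_of_ne_zero L ha0 v)
        (formCongr_toLocalGL_inv_of_simil L H B a hB v)).symm) μω hμu
      (finExplicitCollection L (qsForm L) μω (finExplicitDelta_conj_left_all L (qsForm L) μω) (finExplicitDelta_conj_right_all L (qsForm L) μω)) mH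
      (fun v => (mG v).transport
        (cmDatumLocalCongr L v (toLocalGL L v B)⁻¹ (isUnit_algebraMap_localRing_of_ne_zero L ha0 v) (formCongr_toLocalGL_inv_of_simil L H B a hB v)).symm.toMulEquiv
        (cmDatumLocalCongr L v (toLocalGL L v B)⁻¹ (isUnit_algebraMap_localRing_of_ne_zero L ha0 v) (formCongr_toLocalGL_inv_of_simil L H B a hB v)).symm.continuous
        (cmDatumLocalCongr L v (toLocalGL L v B)⁻¹ (isUnit_algebraMap_localRing_of_ne_zero L ha0 v) (formCongr_toLocalGL_inv_of_simil L H B a hB v)).continuous) :=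
  cmCharIdentityPackageTestSigned_transport_formCongr L H hH hHd (fun v => (toLocalGL L v B)⁻¹) (fun v => algebraMap L (UnitaryGroup.LocalRing L v) a)
    (fun v => isUnit_algebraMap_localRing_of_ne_zero L ha0 v) (fun v => conjLocal_algebraMap_of_cmConj_eq L haσ v)
    (fun v => formCongr_toLocalGL_inv_of_simil L H B a hB v) mH mG νG νH μω hμu hQS

end Simil

end Summit.HodgeConjecture.HodgeConjecture.R90.S9

end
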